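import Summits.FinalStateConjecture.FinalStateConjecture.Theorems.EIHFluxBalanceInertialRecessionSlavingSchwarzschildKSHessian
import Summits.FinalStateConjecture.FinalStateConjecture.Theorems.EIHFluxBalanceInertialRecessionSlavingFarFieldBoost
import Summits.FinalStateConjecture.FinalStateConjecture.Theorems.EIHFluxBalanceInertialRecessionSlavingFarFieldVarCalculus

/-!
# Route EIHFluxBalance — `InertialRecession` (E′), K1 / stub `stub_coerMomKernel` (Bk), far field: rows of `𝓜[Var]` for the linearised Schwarzschild variation, I (rows `P_1, Q_2, A_3` — the boost kernel (A))

Helper file for the crux `stmt-FinalStateConjecture-17403`. For `K = Kerr.bilin 1 0`, `L = boost(v e₁)`, a general `η`-skew rest generator `A` (boost part `b`, rotation part `ω`) and a rest translation `d`, the flat momentum rows `Σ_i (∂_iV_ij − ∂_jV_ii)` of Bk's first-variation field `Var` at the lab offsets `3e₁` (j=1), `3e₂` (j=2), `3e₃` (j=3): lower-triangular in `b` with pivots `(4/9)γ⁻³(1+2v)/(1+v)`, `(4/9)γ²`, `(4/9)γ²` and independent of `ω`.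
Rational boost parametrisation: speed `v = 2s/(1+s²)` along `e₁`, `γ = (1+s²)/(1−s²)`, `|s| < 1` (for the kernel
statements take `0 ≤ s`, i.e. `v ≥ 0`, WLOG after a rotation). Proof pattern: `fderiv_kerrVar_apply` (F2a) /
`fderiv_ltAtom_apply` (F3a), the closed forms `fderiv_fderiv_bilin_zero_spin_apply` (F1), `Schwarzschild.dG`, the inverse
boost in coordinates (F2pre), then `field_simp; ring`. Values cross-checked against the exact rational-function
computation `work/k1/cert_lab.py` (evidence `K1_farfield_rows_lab_offsets.json`). No definitions, no `sorry`. [folklore]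
-/

set_option linter.dupNamespace false
-- instance search through the nested operator types (as in the skeleton / `ChartCurvature`)
set_option maxSynthPendingDepth 6
set_option synthInstance.maxHeartbeats 200000

noncomputable section

open scoped Topology InnerProductSpace
open Filter Set Function Literature.Geometry.Lorentzian Literature.Geometry.Lorentzian.Schwarzschild

namespace Summit.FinalStateConjecture.FinalStateConjecture.Theorems.SublinearIsFree.Slaving

/-- The inverse boost `Λ((2s/(1+s²))e₁)⁻¹` on a vector, in coordinates (bookkeeping for the row tables). [folklore] -/
theorem boost_vel_symm_apply {s : ℝ} (hs : |s| < 1)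
    (hw : ‖((2 * s / (1 + s ^ 2)) • (EuclideanSpace.single 0 1 : E3))‖ < 1) (u : E4) :
    ((Lorentz.boost ((2 * s / (1 + s ^ 2)) • (EuclideanSpace.single 0 1 : E3)) hw : E4 ≃L[ℝ] E4).symm u) =
      ![(1 + s ^ 2) / (1 - s ^ 2) * u 0 - 2 * s / (1 - s ^ 2) * u 1,
        (1 + s ^ 2) / (1 - s ^ 2) * u 1 - 2 * s / (1 - s ^ 2) * u 0, u 2, u 3] := by
  have h := congrArg (fun T : E4 →L[ℝ] E4 ↦ T u) (coe_boost_symm' hw)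
  simp only [ContinuousLinearEquiv.coe_coe] at h
  rw [h, boostCLM_neg_vel_apply hs]

/-- `Λ⁻¹e₁ = (−γv, γ, 0, 0)`. [folklore] -/
theorem boost_vel_symm_basisVector_one {s : ℝ} (hs : |s| < 1)
    (hw : ‖((2 * s / (1 + s ^ 2)) • (EuclideanSpace.single 0 1 : E3))‖ < 1) :
    ((Lorentz.boost ((2 * s / (1 + s ^ 2)) • (EuclideanSpace.single 0 1 : E3)) hw : E4 ≃L[ℝ] E4).symm (E4.basisVector 1)) =
      ![(-(2 * s / (1 - s ^ 2)) : ℝ), (1 + s ^ 2) / (1 - s ^ 2), 0, 0] := by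
  rw [boost_vel_symm_apply hs hw]; funext μ; fin_cases μ <;> simp

/-- `Λ⁻¹e₂ = e₂`. [folklore] -/
theorem boost_vel_symm_basisVector_two {s : ℝ} (hs : |s| < 1)
    (hw : ‖((2 * s / (1 + s ^ 2)) • (EuclideanSpace.single 0 1 : E3))‖ < 1) :
    ((Lorentz.boost ((2 * s / (1 + s ^ 2)) • (EuclideanSpace.single 0 1 : E3)) hw : E4 ≃L[ℝ] E4).symm (E4.basisVector 2)) =
      ![(0 : ℝ), 0, 1, 0] := by
  rw [boost_vel_symm_apply hs hw]; funext μ; fin_cases μ <;> simp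

/-- `Λ⁻¹e₃ = e₃`. [folklore] -/
theorem boost_vel_symm_basisVector_three {s : ℝ} (hs : |s| < 1)
    (hw : ‖((2 * s / (1 + s ^ 2)) • (EuclideanSpace.single 0 1 : E3))‖ < 1) :
    ((Lorentz.boost ((2 * s / (1 + s ^ 2)) • (EuclideanSpace.single 0 1 : E3)) hw : E4 ≃L[ℝ] E4).symm (E4.basisVector 3)) =
      ![(0 : ℝ), 0, 0, 1] := by
  rw [boost_vel_symm_apply hs hw]; funext μ; fin_cases μ <;> simp

set_option maxHeartbeats 1000000 in
/-- **Far-field row `P_1` of `𝓜[Var]`** (lab offset `3e₁`, component `j = 1`) for `K = Kerr.bilin 1 0`,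
`L = boost((2s/(1+s²))e₁)`, a general `η`-skew rest generator (boost part `b`, rotation part `ω`) and rest translation `d`:
`Σ_i (∂_iV_i1 − ∂_1V_ii) = (4/9)γ⁻³(1+2v)/(1+v)·b₁ − (8/27)γ⁻⁴/(1+v)·d₁` (`v = 2s/(1+s²)`, `γ = (1+s²)/(1−s²)`); independent of `ω`, `d₀`. [folklore] -/
theorem farField_row_P1 {s : ℝ} (hs : |s| < 1)
    (hw : ‖((2 * s / (1 + s ^ 2)) • (EuclideanSpace.single 0 1 : E3))‖ < 1)
    (b₁ b₂ b₃ ω₁ ω₂ ω₃ d₀ d₁ d₂ d₃ : ℝ) (A : E4 →L[ℝ] E4)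
    (hA : ∀ u : E4, A u = ![b₁ * u 1 + b₂ * u 2 + b₃ * u 3, b₁ * u 0 - ω₃ * u 2 + ω₂ * u 3,
      b₂ * u 0 + ω₃ * u 1 - ω₁ * u 3, b₃ * u 0 - ω₂ * u 1 + ω₁ * u 2])
    (d : E4) (hd : d = ![d₀, d₁, d₂, d₃]) (V : E4 → E4 →L[ℝ] E4 →L[ℝ] ℝ)
    (hV : ∀ z, V z =
      (fderiv ℝ (Kerr.bilin 1 0) (poincareInv (Lorentz.boost _ hw) 0 z) (A (poincareInv (Lorentz.boost _ hw) 0 z) + d)).bilinearComp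
          (((Lorentz.boost _ hw : E4 ≃L[ℝ] E4).symm : E4 →L[ℝ] E4)) (((Lorentz.boost _ hw : E4 ≃L[ℝ] E4).symm : E4 →L[ℝ] E4)) +
        (Kerr.bilin 1 0 (poincareInv (Lorentz.boost _ hw) 0 z)).bilinearComp
          (A.comp (((Lorentz.boost _ hw : E4 ≃L[ℝ] E4).symm : E4 →L[ℝ] E4))) (((Lorentz.boost _ hw : E4 ≃L[ℝ] E4).symm : E4 →L[ℝ] E4)) +
        (Kerr.bilin 1 0 (poincareInv (Lorentz.boost _ hw) 0 z)).bilinearComp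
          (((Lorentz.boost _ hw : E4 ≃L[ℝ] E4).symm : E4 →L[ℝ] E4)) (A.comp (((Lorentz.boost _ hw : E4 ≃L[ℝ] E4).symm : E4 →L[ℝ] E4)))) :
    ∑ i : Fin 3, (fderiv ℝ V (E4.ofTimeSpace 0 ((3 : ℝ) • EuclideanSpace.single 0 1)) (E4.basisVector i.succ)
        (E4.basisVector i.succ) (E4.basisVector 1) -
      fderiv ℝ V (E4.ofTimeSpace 0 ((3 : ℝ) • EuclideanSpace.single 0 1)) (E4.basisVector 1)
        (E4.basisVector i.succ) (E4.basisVector i.succ)) =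
      4 / 9 * ((1 - s ^ 2) / (1 + s ^ 2)) ^ 3 * ((s ^ 2 + 4 * s + 1) / (1 + s) ^ 2) * b₁ - 8 / 27 * ((1 - s ^ 2) / (1 + s ^ 2)) ^ 4 * ((1 + s ^ 2) / (1 + s) ^ 2) * d₁ := by
  have hVf : V = fun z ↦
      (fderiv ℝ (Kerr.bilin 1 0) (poincareInv (Lorentz.boost _ hw) 0 z) (A (poincareInv (Lorentz.boost _ hw) 0 z) + d)).bilinearComp
          (((Lorentz.boost _ hw : E4 ≃L[ℝ] E4).symm : E4 →L[ℝ] E4)) (((Lorentz.boost _ hw : E4 ≃L[ℝ] E4).symm : E4 →L[ℝ] E4)) +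
        (Kerr.bilin 1 0 (poincareInv (Lorentz.boost _ hw) 0 z)).bilinearComp
          (A.comp (((Lorentz.boost _ hw : E4 ≃L[ℝ] E4).symm : E4 →L[ℝ] E4))) (((Lorentz.boost _ hw : E4 ≃L[ℝ] E4).symm : E4 →L[ℝ] E4)) +
        (Kerr.bilin 1 0 (poincareInv (Lorentz.boost _ hw) 0 z)).bilinearComp
          (((Lorentz.boost _ hw : E4 ≃L[ℝ] E4).symm : E4 →L[ℝ] E4)) (A.comp (((Lorentz.boost _ hw : E4 ≃L[ℝ] E4).symm : E4 →L[ℝ] E4))) := funext hV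
  subst hVf
  have h1 : (1 : ℝ) + s ^ 2 ≠ 0 := by positivity
  have hs2 : s ^ 2 < 1 := by nlinarith [abs_nonneg s, sq_abs s, mul_pos (sub_pos.2 hs) (sub_pos.2 hs)]
  have h2 : (1 : ℝ) - s ^ 2 ≠ 0 := by linarith
  have h3 : (1 : ℝ) + s ≠ 0 := by have := (abs_lt.1 hs).1; linarith
  have hLi := boost_vel_symm_apply hs hw
  have hL1 := boost_vel_symm_basisVector_one hs hw
  have hL2 := boost_vel_symm_basisVector_two hs hw
  have hL3 := boost_vel_symm_basisVector_three hs hw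
  have hts1 : ∀ (t : ℝ) (y : E3), E4.ofTimeSpace t y 1 = y 0 := fun _ _ ↦ rfl
  have hts2 : ∀ (t : ℝ) (y : E3), E4.ofTimeSpace t y 2 = y 1 := fun _ _ ↦ rfl
  have hts3 : ∀ (t : ℝ) (y : E3), E4.ofTimeSpace t y 3 = y 2 := fun _ _ ↦ rfl
  have hy : poincareInv (Lorentz.boost ((2 * s / (1 + s ^ 2)) • (EuclideanSpace.single 0 1 : E3)) hw) 0 (E4.ofTimeSpace 0 ((3 : ℝ) • EuclideanSpace.single 0 1)) = ![(-((2 * s / (1 - s ^ 2)) * 3) : ℝ), ((1 + s ^ 2) / (1 - s ^ 2)) * 3, 0, 0] := by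
    rw [poincareInv_zero, hLi]
    funext μ
    fin_cases μ <;> simp [hts1, hts2, hts3]
  have hyc : (poincareInv (Lorentz.boost ((2 * s / (1 + s ^ 2)) • (EuclideanSpace.single 0 1 : E3)) hw) 0 (E4.ofTimeSpace 0 ((3 : ℝ) • EuclideanSpace.single 0 1))) 1 = ![(-((2 * s / (1 - s ^ 2)) * 3) : ℝ), ((1 + s ^ 2) / (1 - s ^ 2)) * 3, 0, 0] 1 := congrFun hy 1
  have hsp : E4.spatial (poincareInv (Lorentz.boost ((2 * s / (1 + s ^ 2)) • (EuclideanSpace.single 0 1 : E3)) hw) 0 (E4.ofTimeSpace 0 ((3 : ℝ) • EuclideanSpace.single 0 1))) ≠ 0 := by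
    intro h
    have h' := congrArg (fun z : E3 ↦ z 0) h
    simp only [E4.spatial_apply, PiLp.zero_apply] at h'
    rw [show (0 : Fin 3).succ = 1 from rfl, hyc] at h'
    simp at h'
    rcases h' with h' | h'
    · exact h1 (by nlinarith [h'])
    · exact h2 h'
  have hnorm : E4.spatialNorm (poincareInv (Lorentz.boost ((2 * s / (1 + s ^ 2)) • (EuclideanSpace.single 0 1 : E3)) hw) 0 (E4.ofTimeSpace 0 ((3 : ℝ) • EuclideanSpace.single 0 1))) = ((1 + s ^ 2) / (1 - s ^ 2)) * 3 := by
    have hpos : (0 : ℝ) < ((1 + s ^ 2) / (1 - s ^ 2)) * 3 := by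
      have : 0 < 1 - s ^ 2 := by linarith
      positivity
    rw [spatialNorm_eq_sqrt, congrFun hy 1, congrFun hy 2, congrFun hy 3, Real.sqrt_eq_iff_mul_self_eq_of_pos hpos]
    simp
    ring
  have hrad : 0 < Kerr.radius 0 (poincareInv (Lorentz.boost ((2 * s / (1 + s ^ 2)) • (EuclideanSpace.single 0 1 : E3)) hw) 0 (E4.ofTimeSpace 0 ((3 : ℝ) • EuclideanSpace.single 0 1))) := by
    rw [Kerr.radius_zero_left, E4.spatialNorm]; exact norm_pos_iff.2 hsp
  have hs3 : ((2 : Fin 3).succ : Fin 4) = 3 := rfl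
  rw [Fin.sum_univ_three]
  simp only [Fin.succ_zero_eq_one, Fin.succ_one_eq_two, hs3, fderiv_kerrVar_apply 1 0 (Lorentz.boost ((2 * s / (1 + s ^ 2)) • (EuclideanSpace.single 0 1 : E3)) hw) A d hrad,
    fderiv_fderiv_bilin_zero_spin_apply 1 hsp, fderiv_bilin_zero_spin_apply 1 hsp, dG]
  simp only [ell, dEll, sdot_eq, hnorm]
  simp only [hy, hL1, hL2, hL3, hA, hd, PiLp.add_apply, Matrix.cons_val_zero, Matrix.cons_val_one,
    Matrix.head_cons, Matrix.cons_val_two, Matrix.tail_cons, Matrix.cons_val_three,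
    mul_zero, zero_mul, add_zero, zero_add, mul_one, one_mul, sub_zero, zero_sub, neg_zero, zero_div, mul_neg, neg_mul]
  field_simp
  ring

set_option maxHeartbeats 1000000 in
/-- **Far-field row `Q_2` of `𝓜[Var]`** (lab offset `3e₂`, component `j = 2`) for `K = Kerr.bilin 1 0`,
`L = boost((2s/(1+s²))e₁)`, a general `η`-skew rest generator (boost part `b`, rotation part `ω`) and rest translation `d`:
`Σ_i (∂_iV_i2 − ∂_2V_ii) = −(8/9)γ²v·b₁ + (4/9)γ²·b₂ − (4/27)γ²v·d₁ − (8/27)γ²·d₂` (`v = 2s/(1+s²)`, `γ = (1+s²)/(1−s²)`); independent of `ω`, `d₀`. [folklore] -/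
theorem farField_row_Q2 {s : ℝ} (hs : |s| < 1)
    (hw : ‖((2 * s / (1 + s ^ 2)) • (EuclideanSpace.single 0 1 : E3))‖ < 1)
    (b₁ b₂ b₃ ω₁ ω₂ ω₃ d₀ d₁ d₂ d₃ : ℝ) (A : E4 →L[ℝ] E4)
    (hA : ∀ u : E4, A u = ![b₁ * u 1 + b₂ * u 2 + b₃ * u 3, b₁ * u 0 - ω₃ * u 2 + ω₂ * u 3,
      b₂ * u 0 + ω₃ * u 1 - ω₁ * u 3, b₃ * u 0 - ω₂ * u 1 + ω₁ * u 2])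
    (d : E4) (hd : d = ![d₀, d₁, d₂, d₃]) (V : E4 → E4 →L[ℝ] E4 →L[ℝ] ℝ)
    (hV : ∀ z, V z =
      (fderiv ℝ (Kerr.bilin 1 0) (poincareInv (Lorentz.boost _ hw) 0 z) (A (poincareInv (Lorentz.boost _ hw) 0 z) + d)).bilinearComp
          (((Lorentz.boost _ hw : E4 ≃L[ℝ] E4).symm : E4 →L[ℝ] E4)) (((Lorentz.boost _ hw : E4 ≃L[ℝ] E4).symm : E4 →L[ℝ] E4)) +
        (Kerr.bilin 1 0 (poincareInv (Lorentz.boost _ hw) 0 z)).bilinearComp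
          (A.comp (((Lorentz.boost _ hw : E4 ≃L[ℝ] E4).symm : E4 →L[ℝ] E4))) (((Lorentz.boost _ hw : E4 ≃L[ℝ] E4).symm : E4 →L[ℝ] E4)) +
        (Kerr.bilin 1 0 (poincareInv (Lorentz.boost _ hw) 0 z)).bilinearComp
          (((Lorentz.boost _ hw : E4 ≃L[ℝ] E4).symm : E4 →L[ℝ] E4)) (A.comp (((Lorentz.boost _ hw : E4 ≃L[ℝ] E4).symm : E4 →L[ℝ] E4)))) :
    ∑ i : Fin 3, (fderiv ℝ V (E4.ofTimeSpace 0 ((3 : ℝ) • EuclideanSpace.single 1 1)) (E4.basisVector i.succ)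
        (E4.basisVector i.succ) (E4.basisVector 2) -
      fderiv ℝ V (E4.ofTimeSpace 0 ((3 : ℝ) • EuclideanSpace.single 1 1)) (E4.basisVector 2)
        (E4.basisVector i.succ) (E4.basisVector i.succ)) =
      -(8 / 9) * ((1 + s ^ 2) / (1 - s ^ 2)) ^ 2 * (2 * s / (1 + s ^ 2)) * b₁ + 4 / 9 * ((1 + s ^ 2) / (1 - s ^ 2)) ^ 2 * b₂ - 4 / 27 * ((1 + s ^ 2) / (1 - s ^ 2)) ^ 2 * (2 * s / (1 + s ^ 2)) * d₁ - 8 / 27 * ((1 + s ^ 2) / (1 - s ^ 2)) ^ 2 * d₂ := by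
  have hVf : V = fun z ↦
      (fderiv ℝ (Kerr.bilin 1 0) (poincareInv (Lorentz.boost _ hw) 0 z) (A (poincareInv (Lorentz.boost _ hw) 0 z) + d)).bilinearComp
          (((Lorentz.boost _ hw : E4 ≃L[ℝ] E4).symm : E4 →L[ℝ] E4)) (((Lorentz.boost _ hw : E4 ≃L[ℝ] E4).symm : E4 →L[ℝ] E4)) +
        (Kerr.bilin 1 0 (poincareInv (Lorentz.boost _ hw) 0 z)).bilinearComp
          (A.comp (((Lorentz.boost _ hw : E4 ≃L[ℝ] E4).symm : E4 →L[ℝ] E4))) (((Lorentz.boost _ hw : E4 ≃L[ℝ] E4).symm : E4 →L[ℝ] E4)) +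
        (Kerr.bilin 1 0 (poincareInv (Lorentz.boost _ hw) 0 z)).bilinearComp
          (((Lorentz.boost _ hw : E4 ≃L[ℝ] E4).symm : E4 →L[ℝ] E4)) (A.comp (((Lorentz.boost _ hw : E4 ≃L[ℝ] E4).symm : E4 →L[ℝ] E4))) := funext hV
  subst hVf
  have h1 : (1 : ℝ) + s ^ 2 ≠ 0 := by positivity
  have hs2 : s ^ 2 < 1 := by nlinarith [abs_nonneg s, sq_abs s, mul_pos (sub_pos.2 hs) (sub_pos.2 hs)]
  have h2 : (1 : ℝ) - s ^ 2 ≠ 0 := by linarith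
  have h3 : (1 : ℝ) + s ≠ 0 := by have := (abs_lt.1 hs).1; linarith
  have hLi := boost_vel_symm_apply hs hw
  have hL1 := boost_vel_symm_basisVector_one hs hw
  have hL2 := boost_vel_symm_basisVector_two hs hw
  have hL3 := boost_vel_symm_basisVector_three hs hw
  have hts1 : ∀ (t : ℝ) (y : E3), E4.ofTimeSpace t y 1 = y 0 := fun _ _ ↦ rfl
  have hts2 : ∀ (t : ℝ) (y : E3), E4.ofTimeSpace t y 2 = y 1 := fun _ _ ↦ rfl
  have hts3 : ∀ (t : ℝ) (y : E3), E4.ofTimeSpace t y 3 = y 2 := fun _ _ ↦ rfl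
  have hy : poincareInv (Lorentz.boost ((2 * s / (1 + s ^ 2)) • (EuclideanSpace.single 0 1 : E3)) hw) 0 (E4.ofTimeSpace 0 ((3 : ℝ) • EuclideanSpace.single 1 1)) = ![(0 : ℝ), 0, 3, 0] := by
    rw [poincareInv_zero, hLi]
    funext μ
    fin_cases μ <;> simp [hts1, hts2, hts3]
  have hyc : (poincareInv (Lorentz.boost ((2 * s / (1 + s ^ 2)) • (EuclideanSpace.single 0 1 : E3)) hw) 0 (E4.ofTimeSpace 0 ((3 : ℝ) • EuclideanSpace.single 1 1))) 2 = ![(0 : ℝ), 0, 3, 0] 2 := congrFun hy 2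
  have hsp : E4.spatial (poincareInv (Lorentz.boost ((2 * s / (1 + s ^ 2)) • (EuclideanSpace.single 0 1 : E3)) hw) 0 (E4.ofTimeSpace 0 ((3 : ℝ) • EuclideanSpace.single 1 1))) ≠ 0 := by
    intro h
    have h' := congrArg (fun z : E3 ↦ z 1) h
    simp only [E4.spatial_apply, PiLp.zero_apply] at h'
    rw [show (1 : Fin 3).succ = 2 from rfl, hyc] at h'
    simp at h'
  have hnorm : E4.spatialNorm (poincareInv (Lorentz.boost ((2 * s / (1 + s ^ 2)) • (EuclideanSpace.single 0 1 : E3)) hw) 0 (E4.ofTimeSpace 0 ((3 : ℝ) • EuclideanSpace.single 1 1))) = 3 := by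
    have hpos : (0 : ℝ) < 3 := by
      have : 0 < 1 - s ^ 2 := by linarith
      positivity
    rw [spatialNorm_eq_sqrt, congrFun hy 1, congrFun hy 2, congrFun hy 3, Real.sqrt_eq_iff_mul_self_eq_of_pos hpos]
    simp
    norm_num
  have hrad : 0 < Kerr.radius 0 (poincareInv (Lorentz.boost ((2 * s / (1 + s ^ 2)) • (EuclideanSpace.single 0 1 : E3)) hw) 0 (E4.ofTimeSpace 0 ((3 : ℝ) • EuclideanSpace.single 1 1))) := by
    rw [Kerr.radius_zero_left, E4.spatialNorm]; exact norm_pos_iff.2 hsp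
  have hs3 : ((2 : Fin 3).succ : Fin 4) = 3 := rfl
  rw [Fin.sum_univ_three]
  simp only [Fin.succ_zero_eq_one, Fin.succ_one_eq_two, hs3, fderiv_kerrVar_apply 1 0 (Lorentz.boost ((2 * s / (1 + s ^ 2)) • (EuclideanSpace.single 0 1 : E3)) hw) A d hrad,
    fderiv_fderiv_bilin_zero_spin_apply 1 hsp, fderiv_bilin_zero_spin_apply 1 hsp, dG]
  simp only [ell, dEll, sdot_eq, hnorm]
  simp only [hy, hL1, hL2, hL3, hA, hd, PiLp.add_apply, Matrix.cons_val_zero, Matrix.cons_val_one,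
    Matrix.head_cons, Matrix.cons_val_two, Matrix.tail_cons, Matrix.cons_val_three,
    mul_zero, zero_mul, add_zero, zero_add, mul_one, one_mul, sub_zero, zero_sub, neg_zero, zero_div, mul_neg, neg_mul]
  field_simp
  ring

set_option maxHeartbeats 1000000 in
/-- **Far-field row `A_3` of `𝓜[Var]`** (lab offset `3e₃`, component `j = 3`) for `K = Kerr.bilin 1 0`,
`L = boost((2s/(1+s²))e₁)`, a general `η`-skew rest generator (boost part `b`, rotation part `ω`) and rest translation `d`:
`Σ_i (∂_iV_i3 − ∂_3V_ii) = −(8/9)γ²v·b₁ + (4/9)γ²·b₃ − (4/27)γ²v·d₁ − (8/27)γ²·d₃` (`v = 2s/(1+s²)`, `γ = (1+s²)/(1−s²)`); independent of `ω`, `d₀`. [folklore] -/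
theorem farField_row_A3 {s : ℝ} (hs : |s| < 1)
    (hw : ‖((2 * s / (1 + s ^ 2)) • (EuclideanSpace.single 0 1 : E3))‖ < 1)
    (b₁ b₂ b₃ ω₁ ω₂ ω₃ d₀ d₁ d₂ d₃ : ℝ) (A : E4 →L[ℝ] E4)
    (hA : ∀ u : E4, A u = ![b₁ * u 1 + b₂ * u 2 + b₃ * u 3, b₁ * u 0 - ω₃ * u 2 + ω₂ * u 3,
      b₂ * u 0 + ω₃ * u 1 - ω₁ * u 3, b₃ * u 0 - ω₂ * u 1 + ω₁ * u 2])
    (d : E4) (hd : d = ![d₀, d₁, d₂, d₃]) (V : E4 → E4 →L[ℝ] E4 →L[ℝ] ℝ)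
    (hV : ∀ z, V z =
      (fderiv ℝ (Kerr.bilin 1 0) (poincareInv (Lorentz.boost _ hw) 0 z) (A (poincareInv (Lorentz.boost _ hw) 0 z) + d)).bilinearComp
          (((Lorentz.boost _ hw : E4 ≃L[ℝ] E4).symm : E4 →L[ℝ] E4)) (((Lorentz.boost _ hw : E4 ≃L[ℝ] E4).symm : E4 →L[ℝ] E4)) +
        (Kerr.bilin 1 0 (poincareInv (Lorentz.boost _ hw) 0 z)).bilinearComp
          (A.comp (((Lorentz.boost _ hw : E4 ≃L[ℝ] E4).symm : E4 →L[ℝ] E4))) (((Lorentz.boost _ hw : E4 ≃L[ℝ] E4).symm : E4 →L[ℝ] E4)) +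
        (Kerr.bilin 1 0 (poincareInv (Lorentz.boost _ hw) 0 z)).bilinearComp
          (((Lorentz.boost _ hw : E4 ≃L[ℝ] E4).symm : E4 →L[ℝ] E4)) (A.comp (((Lorentz.boost _ hw : E4 ≃L[ℝ] E4).symm : E4 →L[ℝ] E4)))) :
    ∑ i : Fin 3, (fderiv ℝ V (E4.ofTimeSpace 0 ((3 : ℝ) • EuclideanSpace.single 2 1)) (E4.basisVector i.succ)
        (E4.basisVector i.succ) (E4.basisVector 3) -
      fderiv ℝ V (E4.ofTimeSpace 0 ((3 : ℝ) • EuclideanSpace.single 2 1)) (E4.basisVector 3)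
        (E4.basisVector i.succ) (E4.basisVector i.succ)) =
      -(8 / 9) * ((1 + s ^ 2) / (1 - s ^ 2)) ^ 2 * (2 * s / (1 + s ^ 2)) * b₁ + 4 / 9 * ((1 + s ^ 2) / (1 - s ^ 2)) ^ 2 * b₃ - 4 / 27 * ((1 + s ^ 2) / (1 - s ^ 2)) ^ 2 * (2 * s / (1 + s ^ 2)) * d₁ - 8 / 27 * ((1 + s ^ 2) / (1 - s ^ 2)) ^ 2 * d₃ := by
  have hVf : V = fun z ↦
      (fderiv ℝ (Kerr.bilin 1 0) (poincareInv (Lorentz.boost _ hw) 0 z) (A (poincareInv (Lorentz.boost _ hw) 0 z) + d)).bilinearComp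
          (((Lorentz.boost _ hw : E4 ≃L[ℝ] E4).symm : E4 →L[ℝ] E4)) (((Lorentz.boost _ hw : E4 ≃L[ℝ] E4).symm : E4 →L[ℝ] E4)) +
        (Kerr.bilin 1 0 (poincareInv (Lorentz.boost _ hw) 0 z)).bilinearComp
          (A.comp (((Lorentz.boost _ hw : E4 ≃L[ℝ] E4).symm : E4 →L[ℝ] E4))) (((Lorentz.boost _ hw : E4 ≃L[ℝ] E4).symm : E4 →L[ℝ] E4)) +
        (Kerr.bilin 1 0 (poincareInv (Lorentz.boost _ hw) 0 z)).bilinearComp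
          (((Lorentz.boost _ hw : E4 ≃L[ℝ] E4).symm : E4 →L[ℝ] E4)) (A.comp (((Lorentz.boost _ hw : E4 ≃L[ℝ] E4).symm : E4 →L[ℝ] E4))) := funext hV
  subst hVf
  have h1 : (1 : ℝ) + s ^ 2 ≠ 0 := by positivity
  have hs2 : s ^ 2 < 1 := by nlinarith [abs_nonneg s, sq_abs s, mul_pos (sub_pos.2 hs) (sub_pos.2 hs)]
  have h2 : (1 : ℝ) - s ^ 2 ≠ 0 := by linarith
  have h3 : (1 : ℝ) + s ≠ 0 := by have := (abs_lt.1 hs).1; linarith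
  have hLi := boost_vel_symm_apply hs hw
  have hL1 := boost_vel_symm_basisVector_one hs hw
  have hL2 := boost_vel_symm_basisVector_two hs hw
  have hL3 := boost_vel_symm_basisVector_three hs hw
  have hts1 : ∀ (t : ℝ) (y : E3), E4.ofTimeSpace t y 1 = y 0 := fun _ _ ↦ rfl
  have hts2 : ∀ (t : ℝ) (y : E3), E4.ofTimeSpace t y 2 = y 1 := fun _ _ ↦ rfl
  have hts3 : ∀ (t : ℝ) (y : E3), E4.ofTimeSpace t y 3 = y 2 := fun _ _ ↦ rfl
  have hy : poincareInv (Lorentz.boost ((2 * s / (1 + s ^ 2)) • (EuclideanSpace.single 0 1 : E3)) hw) 0 (E4.ofTimeSpace 0 ((3 : ℝ) • EuclideanSpace.single 2 1)) = ![(0 : ℝ), 0, 0, 3] := by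
    rw [poincareInv_zero, hLi]
    funext μ
    fin_cases μ <;> simp [hts1, hts2, hts3]
  have hyc : (poincareInv (Lorentz.boost ((2 * s / (1 + s ^ 2)) • (EuclideanSpace.single 0 1 : E3)) hw) 0 (E4.ofTimeSpace 0 ((3 : ℝ) • EuclideanSpace.single 2 1))) 3 = ![(0 : ℝ), 0, 0, 3] 3 := congrFun hy 3
  have hsp : E4.spatial (poincareInv (Lorentz.boost ((2 * s / (1 + s ^ 2)) • (EuclideanSpace.single 0 1 : E3)) hw) 0 (E4.ofTimeSpace 0 ((3 : ℝ) • EuclideanSpace.single 2 1))) ≠ 0 := by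
    intro h
    have h' := congrArg (fun z : E3 ↦ z 2) h
    simp only [E4.spatial_apply, PiLp.zero_apply] at h'
    rw [show (2 : Fin 3).succ = 3 from rfl, hyc] at h'
    simp at h'
  have hnorm : E4.spatialNorm (poincareInv (Lorentz.boost ((2 * s / (1 + s ^ 2)) • (EuclideanSpace.single 0 1 : E3)) hw) 0 (E4.ofTimeSpace 0 ((3 : ℝ) • EuclideanSpace.single 2 1))) = 3 := by
    have hpos : (0 : ℝ) < 3 := by
      have : 0 < 1 - s ^ 2 := by linarith
      positivity
    rw [spatialNorm_eq_sqrt, congrFun hy 1, congrFun hy 2, congrFun hy 3, Real.sqrt_eq_iff_mul_self_eq_of_pos hpos]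
    simp
    norm_num
  have hrad : 0 < Kerr.radius 0 (poincareInv (Lorentz.boost ((2 * s / (1 + s ^ 2)) • (EuclideanSpace.single 0 1 : E3)) hw) 0 (E4.ofTimeSpace 0 ((3 : ℝ) • EuclideanSpace.single 2 1))) := by
    rw [Kerr.radius_zero_left, E4.spatialNorm]; exact norm_pos_iff.2 hsp
  have hs3 : ((2 : Fin 3).succ : Fin 4) = 3 := rfl
  rw [Fin.sum_univ_three]
  simp only [Fin.succ_zero_eq_one, Fin.succ_one_eq_two, hs3, fderiv_kerrVar_apply 1 0 (Lorentz.boost ((2 * s / (1 + s ^ 2)) • (EuclideanSpace.single 0 1 : E3)) hw) A d hrad,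
    fderiv_fderiv_bilin_zero_spin_apply 1 hsp, fderiv_bilin_zero_spin_apply 1 hsp, dG]
  simp only [ell, dEll, sdot_eq, hnorm]
  simp only [hy, hL1, hL2, hL3, hA, hd, PiLp.add_apply, Matrix.cons_val_zero, Matrix.cons_val_one,
    Matrix.head_cons, Matrix.cons_val_two, Matrix.tail_cons, Matrix.cons_val_three,
    mul_zero, zero_mul, add_zero, zero_add, mul_one, one_mul, sub_zero, zero_sub, neg_zero, zero_div, mul_neg, neg_mul]
  field_simp
  ring

/-- Registered carrier `slaving_farFieldRowsA_slaving12` of the crux item (= `farField_row_P1`). [folklore] -/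
theorem slaving_farFieldRowsA_slaving12 : open Literature.Geometry.Lorentzian Literature.Geometry.Lorentzian.Schwarzschild in ∀ {s : ℝ} (hs : |s| < 1) (hw : ‖((2 * s / (1 + s ^ 2)) • (EuclideanSpace.single 0 1 : E3))‖ < 1) (b₁ b₂ b₃ ω₁ ω₂ ω₃ d₀ d₁ d₂ d₃ : ℝ) (A : E4 →L[ℝ] E4) (hA : ∀ u : E4, A u = ![b₁ * u 1 + b₂ * u 2 + b₃ * u 3, b₁ * u 0 - ω₃ * u 2 + ω₂ * u 3, b₂ * u 0 + ω₃ * u 1 - ω₁ * u 3, b₃ * u 0 - ω₂ * u 1 + ω₁ * u 2]) (d : E4) (hd : d = ![d₀, d₁, d₂, d₃]) (V : E4 → E4 →L[ℝ] E4 →L[ℝ] ℝ) (hV : ∀ z, V z = (fderiv ℝ (Kerr.bilin 1 0) (poincareInv (Lorentz.boost _ hw) 0 z) (A (poincareInv (Lorentz.boost _ hw) 0 z) + d)).bilinearComp (((Lorentz.boost _ hw : E4 ≃L[ℝ] E4).symm : E4 →L[ℝ] E4)) (((Lorentz.boost _ hw : E4 ≃L[ℝ] E4).symm : E4 →L[ℝ]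 E4)) + (Kerr.bilin 1 0 (poincareInv (Lorentz.boost _ hw) 0 z)).bilinearComp (A.comp (((Lorentz.boost _ hw : E4 ≃L[ℝ] E4).symm : E4 →L[ℝ] E4))) (((Lorentz.boost _ hw : E4 ≃L[ℝ] E4).symm : E4 →L[ℝ] E4)) + (Kerr.bilin 1 0 (poincareInv (Lorentz.boost _ hw) 0 z)).bilinearComp (((Lorentz.boost _ hw : E4 ≃L[ℝ] E4).symm : E4 →L[ℝ] E4)) (A.comp (((Lorentz.boost _ hw : E4 ≃L[ℝ] E4).symm : E4 →L[ℝ] E4)))), ∑ i : Fin 3, (fderiv ℝ V (E4.ofTimeSpace 0 ((3 : ℝ) • EuclideanSpace.single 0 1)) (E4.basisVector i.succ) (E4.basisVector i.succ) (E4.basisVector 1) - fderiv ℝ V (E4.ofTimeSpace 0 ((3 : ℝ) • EuclideanSpace.single 0 1)) (E4.basisVector 1) (E4.basisVector i.succ) (E4.basisVector i.succ)) = 4 / 9 * ((1 - s ^ 2) / (1 + s ^ 2)) ^ 3 * ((s ^ 2 + 4 * s + 1) / (1 + s) ^ 2) * b₁ - 8 / 27 * ((1 - s ^ 2) / (1 +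 s ^ 2)) ^ 4 * ((1 + s ^ 2) / (1 + s) ^ 2) * d₁ :=
  farField_row_P1

end Summit.FinalStateConjecture.FinalStateConjecture.Theorems.SublinearIsFree.Slaving
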